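import Summits.ResolutionOfSingularities.ResolutionOfSingularities.Theorems.FrobeniusLadderFInjectiveMacaulayficationWildPinchFan
import Summits.ResolutionOfSingularities.ResolutionOfSingularities.Theorems.FrobeniusLadderFInjectiveMacaulayficationT11Char3Frame
import Summits.ResolutionOfSingularities.ResolutionOfSingularities.Theorems.FrobeniusLadderFInjectiveMacaulayficationMonomialChartPresentationKernel
import Summits.ResolutionOfSingularities.ResolutionOfSingularities.Theorems.FrobeniusLadderFInjectiveMacaulayficationBlowupFiModelOfCoverOverClosed
import Summits.ResolutionOfSingularities.ResolutionOfSingularities.Theorems.FrobeniusLadderFInjectiveMacaulayficationClauseOfPderivNotMem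
import Summits.ResolutionOfSingularities.ResolutionOfSingularities.Theorems.FrobeniusLadderFInjectiveMacaulayficationE8Char5FiModel
import Summits.ResolutionOfSingularities.ResolutionOfSingularities.Theorems.FrobeniusLadderFInjectiveMacaulayficationDegreeZeroDescentLocal
import Summits.ResolutionOfSingularities.ResolutionOfSingularities.Theorems.FrobeniusLadderFInjectiveMacaulayficationFCForallExistsCylinder
import Literature.AlgebraicGeometry.Resolution.BlowupsScaling
import Mathlib.Algebra.CharP.Algebra
import HarnessLib

/-!
# #4β at the WILD PINCH POINT, part 2/2: the first wild-point instance of `stub_closedCentreExists` in Lean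
# (crux `FInjectiveMacaulayfication` stmt-ResolutionOfSingularities-15315, chain w45a, door v30 = DM ∧ #4β ∧ FC″)

[OURS · L1 W4.5a · res-L1-w45a-lead-1 gen 5] Support file (`--supports stmt-ResolutionOfSingularities-15315 --as helper`); NOT a
statement of any manuscript; AI-written, weaker than expert review.

The specimen. `k` a field of characteristic `2`, `f = y² + u²ty + ut² ∈ k[y,u,t]` (variables `(y,u,t) = (X₀,X₁,X₂)`),
`X₁ = Spec R̄`, `R̄ = k[X]/(f)` — res-L1-w45a-strat-1's WILD PINCH (`H4LOC-KILL-WILDPINCH.md`, Thm W; plan-1 RULING R13.34): its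
origin is a bad point at which the guarded step 5e (`h4Loc`, point-fixability) FAILS, which is why door v30 registers the closed-centre
form #4β (`stub_closedCentreExists`: SOME non-zero ideal sheaf `J` through the bad point all of whose blowings up are FULL over
`supp J`). This file proves #4β's conclusion for this specimen, at every point of `D = V(y,t) = Sing X₁` (in particular at the
origin), with the centre `J = 𝓘_D = (ȳ, t̄)~`:

* (part 1, `…WildPinchFan`) §1 `Fan02of3.*` — the two-chart fan of the blowing up of `𝔸³` along the line `y = t = 0` (tables, `decide`), in the binder
  shapes of (C1) `MonomialChartPresentationKernel.exists_monomialChartPresentation` (the padded monomial centre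
  `I_A = (y, t, y², t², yu, tu) = (y, t)`);
* (part 1) §2 polynomial identities: the strict transforms `g₀ = 1 + u²T + uT²` (chart `y`), `g₁ = S² + u²S + u` (chart `t`), their
  partial derivatives, `f` prime (Eisenstein at `(u) ⊂ k[u,t]` for the monic quadratic `f ∈ k[u,t][y]`) and dividing no variable;
* §3 `affineBlowup_full` — EVERY stalk of `Bl_{(ȳ,t̄)} X₁` is a domain satisfying the crux clause: the base is regular off `D`
  (`∂f/∂u = t²`), both charts are regular hypersurfaces (`∂g₁/∂u = 1`; `∂g₀/∂T = u²` with `u` a unit along `g₀ = 0 ∩ V(u) = ∅`),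
  by the Jacobian discharger `ClauseOfPderivNotMem.stub_clauseOfPderivNotMem` and the chart glue
  `BlowupFiModelOfCoverOverClosed.blowupClause_over_closed` (with `𝔟 = 0`);
* §4 `closedCentreExists_wildPinch` — the #4β package: `J = (ȳ,t̄)~ ≠ ⊥`, every point of `D` lies in `supp J`, and EVERY blowing
  up `π : X' → X₁` along `J` is FULL at EVERY point (`IsBlowupStalkTransfer`).

So the wild pinch, which kills the point form 5e, passes the closed-centre form #4β with the reduced singular locus as centre —
the first worked WILD point of the crux chain (strat-1's `WFix` line, dimension 2). [folklore mathematics: blowing up the pinch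
line resolves the surface; the content here is the certificate in the crux's clause language]
-/

-- single-problem summit: the doubled namespace component is forced
set_option linter.dupNamespace false

noncomputable section

namespace Summit.ResolutionOfSingularities.ResolutionOfSingularities.Theorems.FInjectiveMacaulayfication.WildPinchClosedCentre

open AlgebraicGeometry CategoryTheory Literature.AlgebraicGeometry.Resolution MvPolynomial
open Summit.ResolutionOfSingularities.ResolutionOfSingularities.Theorems.FInjectiveMacaulayfication

/-! ## §3 Every stalk of `Bl_{(ȳ,t̄)} X₁` is a domain satisfying the crux clause -/

/-- `R̄ = k[y,u,t]/(f)` is a domain. [folklore] -/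
theorem isDomain_wildPinch (k : Type) [Field k] (f : MvPolynomial (Fin 3) k)
    (hf : f = X 0 ^ 2 + X 1 ^ 2 * X 2 * X 0 + X 1 * X 2 ^ 2) : IsDomain (MvPolynomial (Fin 3) k ⧸ Ideal.span {f}) :=
  (Ideal.Quotient.isDomain_iff_prime _).mpr
    ((Ideal.span_singleton_prime (prime_wildPinch k f hf).1.ne_zero).mpr (prime_wildPinch k f hf).1)

/-- The chart denominators `ȳ = x̄^{m 0}`, `t̄ = x̄^{m 1}` are non-zero in `R̄`. [folklore] -/
theorem mk_monomial_m_ne_zero (k : Type) [Field k] (f : MvPolynomial (Fin 3) k)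
    (hf : f = X 0 ^ 2 + X 1 ^ 2 * X 2 * X 0 + X 1 * X 2 ^ 2) :
    ∀ c : Fin 2, Ideal.Quotient.mk (Ideal.span {f}) (monomial (Fan02of3.m c) (1 : k)) ≠ 0 := by
  intro c
  rw [Fan02of3.m_eq_single, ← X_pow_eq_monomial, pow_one, Ne, Ideal.Quotient.eq_zero_iff_mem, Ideal.mem_span_singleton]
  exact (prime_wildPinch k f hf).2 _

set_option maxHeartbeats 800000 in
/-- **One chart of `Bl_{I_A} X₁` presented as a regular hypersurface satisfies the clause at its closed points.** If `θ_c f = x^{2e_{jc c}}·g`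
with no variable dividing `g` (so (C1) presents the chart ring as `k[X]/(g)`), and some partial `∂g/∂X_j` lies in NO prime of `k[X]/(g)`,
then every local ring of the chart ring `R̄[I_A/x̄^{m c}]` at a maximal ideal satisfies the crux clause (exponent base `2`): transport
of `ClauseOfPderivNotMem.stub_clauseOfPderivNotMem` along the presentation and `E8Char5FiModel.nonempty_ringEquiv_localization_comap`.
[folklore] -/
theorem chart_clause (k : Type) [Field k] [CharP k 2] (f : MvPolynomial (Fin 3) k) (c : Fin 2) (g : MvPolynomial (Fin 3) k)
    (hg : aeval (fun j : Fin 3 => ∏ i : Fin 3, (X i : MvPolynomial (Fin 3) k) ^ Fan02of3.V c i j) f =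
      monomial (Finsupp.single (Fan02of3.jc c) 2) (1 : k) * g)
    (hcop : ∀ i : Fin 3, ¬ (X i ∣ g)) (j : Fin 3)
    (hreg : ∀ P : Ideal (MvPolynomial (Fin 3) k ⧸ Ideal.span {g}), P.IsPrime →
      pderiv j g ∉ P.comap (Ideal.Quotient.mk (Ideal.span {g})))
    (Q : Ideal ↥(Literature.AlgebraicGeometry.Resolution.blowupAlgebra
      (Ideal.span ((fun e : Fin 3 →₀ ℕ => Ideal.Quotient.mk (Ideal.span {f}) (monomial e (1 : k))) '' (Fan02of3.A : Set (Fin 3 →₀ ℕ))))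
      (Ideal.Quotient.mk (Ideal.span {f}) (monomial (Fan02of3.m c) (1 : k))))) [Q.IsMaximal] :
    ∀ d : ℕ, ringKrullDim (Localization.AtPrime Q) = d → ∀ s : Fin d → Localization.AtPrime Q,
      (Ideal.span (Set.range s)).radical.IsMaximal →
        RingTheory.Sequence.IsWeaklyRegular (Localization.AtPrime Q) (List.ofFn s) ∧
        ∀ y : Localization.AtPrime Q, (∃ e : ℕ, y ^ 2 ^ e ∈ Ideal.span
          ((fun z : Localization.AtPrime Q => z ^ 2 ^ e) ''
            (Ideal.span (Set.range s) : Set (Localization.AtPrime Q)))) → y ∈ Ideal.span (Set.range s) := by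
  haveI : Fact (Nat.Prime 2) := ⟨Nat.prime_two⟩
  have H := MonomialChartPresentationKernel.exists_monomialChartPresentation f (Fan02of3.V c) (Fan02of3.hV c)
    (Fan02of3.m c) (Fan02of3.a c) (Fan02of3.hgen c) Fan02of3.A (Fan02of3.haA c) (Fan02of3.hge c)
    (Finsupp.single (Fan02of3.jc c) 2) g hg (Fan02of3.hunit c) hcop
  obtain ⟨e, hrest⟩ := H
  let ε := RingEquiv.ofBijective e hrest.1
  haveI hQ' : (Q.comap ε.toRingHom).IsMaximal := Ideal.comap_isMaximal_of_surjective _ ε.surjective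
  have hcl := ClauseOfPderivNotMem.stub_clauseOfPderivNotMem 2 k 3 g (Q.comap ε.toRingHom) j (hreg _ hQ'.isPrime)
  obtain ⟨eloc⟩ := E8Char5FiModel.nonempty_ringEquiv_localization_comap ε Q
  exact DegreeZeroDescent.inlineClause_of_ringEquiv 2 eloc hcl

/-- Chart `y`: `∂g₀/∂T = u²` lies in no prime `P` of `k[X]/(g₀)` — `u ∈ P` would give `1 = g₀ − u(uT + T²) ∈ P`. [folklore] -/
theorem hreg_zero (k : Type) [Field k] [CharP k 2] :
    ∀ P : Ideal (MvPolynomial (Fin 3) k ⧸ Ideal.span {(1 + X 1 ^ 2 * X 2 + X 1 * X 2 ^ 2 : MvPolynomial (Fin 3) k)}), P.IsPrime →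
      pderiv 2 (1 + X 1 ^ 2 * X 2 + X 1 * X 2 ^ 2 : MvPolynomial (Fin 3) k) ∉ P.comap (Ideal.Quotient.mk _) := by
  intro P hP h
  rw [pderiv_two_g0] at h
  have hP' : (P.comap (Ideal.Quotient.mk (Ideal.span {(1 + X 1 ^ 2 * X 2 + X 1 * X 2 ^ 2 : MvPolynomial (Fin 3) k)}))).IsPrime :=
    Ideal.comap_isPrime _ _
  have hX1 := hP'.mem_of_pow_mem 2 h
  have hg : (1 + X 1 ^ 2 * X 2 + X 1 * X 2 ^ 2 : MvPolynomial (Fin 3) k) ∈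
      P.comap (Ideal.Quotient.mk (Ideal.span {(1 + X 1 ^ 2 * X 2 + X 1 * X 2 ^ 2 : MvPolynomial (Fin 3) k)})) := by
    rw [Ideal.mem_comap, Ideal.Quotient.eq_zero_iff_mem.mpr (Ideal.mem_span_singleton_self _)]
    exact zero_mem _
  have h1 : (1 + X 1 ^ 2 * X 2 + X 1 * X 2 ^ 2 : MvPolynomial (Fin 3) k) - X 1 * (X 1 * X 2 + X 2 ^ 2) = 1 := by ring
  have hmem := sub_mem hg (Ideal.mul_mem_right (X 1 * X 2 + X 2 ^ 2) _ hX1)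
  rw [h1] at hmem
  exact hP'.ne_top ((Ideal.eq_top_iff_one _).mpr hmem)

/-- Chart `t`: `∂g₁/∂u = 1` lies in no prime of `k[X]/(g₁)`. [folklore] -/
theorem hreg_one (k : Type) [Field k] [CharP k 2] :
    ∀ P : Ideal (MvPolynomial (Fin 3) k ⧸ Ideal.span {(X 0 ^ 2 + X 1 ^ 2 * X 0 + X 1 : MvPolynomial (Fin 3) k)}), P.IsPrime →
      pderiv 1 (X 0 ^ 2 + X 1 ^ 2 * X 0 + X 1 : MvPolynomial (Fin 3) k) ∉ P.comap (Ideal.Quotient.mk _) := by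
  intro P hP h
  rw [pderiv_one_g1] at h
  exact (Ideal.comap_isPrime _ _ : (P.comap _).IsPrime).ne_top ((Ideal.eq_top_iff_one _).mpr h)

/-- **§3 — EVERY STALK OF `Bl_{(ȳ,t̄)} X₁` IS A DOMAIN SATISFYING THE CRUX CLAUSE** (`X₁ = Spec k[y,u,t]/(y²+u²ty+ut²)`, `char k = 2`,
centre `I = I_A R̄ = (ȳ, t̄)` the reduced singular line): off `V(I)` the surface is regular (`∂f/∂u = t²`, and `t ∈ Q` forces `y ∈ Q`,
i.e. `I ≤ Q`); over `V(I)` the two Rees charts are the regular hypersurfaces `1 + u²T + uT²`, `S² + u²S + u` (`chart_clause`); glue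
`BlowupFiModelOfCoverOverClosed.blowupClause_over_closed` with `𝔟 = 0`, cover `T11Char3Frame.reesCover_of_fanCover`. [folklore] -/
theorem affineBlowup_full (k : Type) [Field k] [CharP k 2] (f : MvPolynomial (Fin 3) k)
    (hf : f = X 0 ^ 2 + X 1 ^ 2 * X 2 * X 0 + X 1 * X 2 ^ 2)
    (I : Ideal (MvPolynomial (Fin 3) k ⧸ Ideal.span {f}))
    (hI : I = Ideal.span ((fun e : Fin 3 →₀ ℕ => Ideal.Quotient.mk (Ideal.span {f}) (monomial e (1 : k))) ''
      (Fan02of3.A : Set (Fin 3 →₀ ℕ)))) :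
    ∀ y : ↥(affineBlowup I), IsDomain ((affineBlowup I).presheaf.stalk y) ∧
      ∀ d : ℕ, ringKrullDim ((affineBlowup I).presheaf.stalk y) = d →
        ∀ s : Fin d → (affineBlowup I).presheaf.stalk y, (Ideal.span (Set.range s)).radical.IsMaximal →
          RingTheory.Sequence.IsWeaklyRegular ((affineBlowup I).presheaf.stalk y) (List.ofFn s) ∧
          ∀ z : (affineBlowup I).presheaf.stalk y, (∃ e : ℕ, z ^ 2 ^ e ∈
              Ideal.span ((fun w : (affineBlowup I).presheaf.stalk y => w ^ 2 ^ e) ''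
                (Ideal.span (Set.range s) : Set ((affineBlowup I).presheaf.stalk y)))) →
            z ∈ Ideal.span (Set.range s) := by
  subst hI
  haveI : Fact (Nat.Prime 2) := ⟨Nat.prime_two⟩
  haveI hdom : IsDomain (MvPolynomial (Fin 3) k ⧸ Ideal.span {f}) := isDomain_wildPinch k f hf
  haveI : CharP (MvPolynomial (Fin 3) k ⧸ Ideal.span {f}) 2 :=
    charP_of_injective_algebraMap (algebraMap k (MvPolynomial (Fin 3) k ⧸ Ideal.span {f})).injective 2
  have hv : ∀ c : Fin 2, Ideal.Quotient.mk (Ideal.span {f}) (monomial (Fan02of3.m c) (1 : k)) ∈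
      Ideal.span ((fun e : Fin 3 →₀ ℕ => Ideal.Quotient.mk (Ideal.span {f}) (monomial e (1 : k))) '' (Fan02of3.A : Set (Fin 3 →₀ ℕ))) :=
    fun c => Ideal.subset_span ⟨Fan02of3.m c, Fan02of3.hmA c, rfl⟩
  intro y
  refine BlowupFiModelOfCoverOverClosed.blowupClause_over_closed 2 (MvPolynomial (Fin 3) k ⧸ Ideal.span {f}) _ 2
    (fun c => Ideal.Quotient.mk (Ideal.span {f}) (monomial (Fan02of3.m c) (1 : k))) hv (mk_monomial_m_ne_zero k f hf)
    (T11Char3Frame.reesCover_of_fanCover f Fan02of3.A Fan02of3.m Fan02of3.hmA (Fan02of3.hcov k)) ⊥ ?_ ?_ y bot_le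
  · -- off `V(I)`: `∂f/∂u = t² ∉ Q`, for `t ∈ Q ⇒ y² = f − t(u²y + ut) ∈ Q ⇒ I = (y, t, …) ≤ Q`
    intro Q hQ hIQ _
    refine ClauseOfPderivNotMem.stub_clauseOfPderivNotMem 2 k 3 f Q 1 ?_
    rw [pderiv_one_f k f hf]
    intro h2
    have hP : (Q.comap (Ideal.Quotient.mk (Ideal.span {f}))).IsPrime := Ideal.comap_isPrime _ _
    have hX2 : (X 2 : MvPolynomial (Fin 3) k) ∈ Q.comap (Ideal.Quotient.mk (Ideal.span {f})) := hP.mem_of_pow_mem 2 h2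
    have hfP : f ∈ Q.comap (Ideal.Quotient.mk (Ideal.span {f})) := by
      rw [Ideal.mem_comap, Ideal.Quotient.eq_zero_iff_mem.mpr (Ideal.mem_span_singleton_self f)]
      exact zero_mem _
    have hX0 : (X 0 : MvPolynomial (Fin 3) k) ∈ Q.comap (Ideal.Quotient.mk (Ideal.span {f})) := by
      refine hP.mem_of_pow_mem 2 ?_
      have h02 : (X 0 : MvPolynomial (Fin 3) k) ^ 2 = f - X 2 * (X 1 ^ 2 * X 0 + X 1 * X 2) := by rw [hf]; ring
      rw [h02]
      exact sub_mem hfP (Ideal.mul_mem_right _ _ hX2)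
    refine hIQ (Ideal.span_le.mpr ?_)
    rintro _ ⟨a, ha, rfl⟩
    obtain ⟨j, hj, hja⟩ := Fan02of3.hAJ a ha
    have hXj : (X j : MvPolynomial (Fin 3) k) ∈ Q.comap (Ideal.Quotient.mk (Ideal.span {f})) := by
      simp only [Fan02of3.J, Finset.mem_insert, Finset.mem_singleton] at hj
      rcases hj with rfl | rfl
      · exact hX0
      · exact hX2
    have hdvd : (X j : MvPolynomial (Fin 3) k) ∣ monomial a 1 :=
      monomial_dvd_monomial.mpr ⟨Or.inr (Finsupp.single_le_iff.mpr hja), one_dvd _⟩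
    obtain ⟨q, hq⟩ := hdvd
    change Ideal.Quotient.mk (Ideal.span {f}) (monomial a 1) ∈ Q
    rw [hq, map_mul]
    exact Q.mul_mem_right _ (Ideal.mem_comap.mp hXj)
  · -- over `V(I)`: the two charts
    intro c Q hQ _ _
    fin_cases c
    · exact @chart_clause k _ _ f 0 _ (theta_zero f hf) hcop_zero 2 (hreg_zero k) Q hQ
    · exact @chart_clause k _ _ f 1 _ (theta_one f hf) hcop_one 1 (hreg_one k) Q hQ

/-! ## §4 The #4β package at the wild pinch -/

/-- **#4β AT THE WILD PINCH (centre in the fan form `I = I_A R̄`)** — see `closedCentreExists_wildPinch` for the form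
`I = (ȳ, t̄)`. **`closedCentreExists` for `X₁ = Spec k[y,u,t]/(y²+u²ty+ut²)`, `char k = 2`, AT EVERY POINT OF
`D = V(ȳ, t̄) = Sing X₁`** (in particular at the origin, strat-1's wild pinch point where the point form 5e fails): with
`J := (I_A R̄)~ = (ȳ, t̄)~`, `J ≠ ⊥`, `b ∈ supp J` for every `b ⊇ I`, and EVERY blowing up `π : X' → X₁` along `J` has all its
stalks over `supp J` (indeed all its stalks) domains satisfying the crux clause — `affineBlowup_full` moved along
`IsBlowupStalkTransfer.stub_isBlowupStalkTransfer`. Literally the conclusion of door v30's `stub_closedCentreExists` for this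
`X₁` and these `b`. [folklore mathematics; OURS as a certificate] -/
theorem closedCentreExists_wildPinch_A (k : Type) [Field k] [CharP k 2] (f : MvPolynomial (Fin 3) k)
    (hf : f = X 0 ^ 2 + X 1 ^ 2 * X 2 * X 0 + X 1 * X 2 ^ 2)
    (I : Ideal (MvPolynomial (Fin 3) k ⧸ Ideal.span {f}))
    (hI : I = Ideal.span ((fun e : Fin 3 →₀ ℕ => Ideal.Quotient.mk (Ideal.span {f}) (monomial e (1 : k))) ''
      (Fan02of3.A : Set (Fin 3 →₀ ℕ))))
    (b : ↥(Spec (.of (MvPolynomial (Fin 3) k ⧸ Ideal.span {f})))) (hb : I ≤ b.asIdeal) :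
    ∃ J : (Spec (.of (MvPolynomial (Fin 3) k ⧸ Ideal.span {f}))).IdealSheafData, J ≠ ⊥ ∧
      b ∈ (J.support : Set ↥(Spec (.of (MvPolynomial (Fin 3) k ⧸ Ideal.span {f})))) ∧
      ∀ (X' : Scheme.{0}) (π : X' ⟶ Spec (.of (MvPolynomial (Fin 3) k ⧸ Ideal.span {f}))),
        Literature.AlgebraicGeometry.Resolution.IsBlowup π J →
        ∀ x' : X', π.base x' ∈ (J.support : Set ↥(Spec (.of (MvPolynomial (Fin 3) k ⧸ Ideal.span {f})))) →
          IsDomain (X'.presheaf.stalk x') ∧ ∀ d : ℕ, ringKrullDim (X'.presheaf.stalk x') = d →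
            ∀ s : Fin d → X'.presheaf.stalk x', (Ideal.span (Set.range s)).radical.IsMaximal →
              RingTheory.Sequence.IsWeaklyRegular (X'.presheaf.stalk x') (List.ofFn s) ∧
              ∀ z : X'.presheaf.stalk x', (∃ e : ℕ, z ^ 2 ^ e ∈
                  Ideal.span ((fun w : X'.presheaf.stalk x' => w ^ 2 ^ e) ''
                    (Ideal.span (Set.range s) : Set (X'.presheaf.stalk x')))) → z ∈ Ideal.span (Set.range s) := by
  haveI : Fact (Nat.Prime 2) := ⟨Nat.prime_two⟩
  have hI0 : I ≠ ⊥ := by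
    intro h0
    have hmem : Ideal.Quotient.mk (Ideal.span {f}) (monomial (Fan02of3.m 0) (1 : k)) ∈ I :=
      hI ▸ Ideal.subset_span ⟨Fan02of3.m 0, Fan02of3.hmA 0, rfl⟩
    rw [h0, Ideal.mem_bot] at hmem
    exact mk_monomial_m_ne_zero k f hf 0 hmem
  refine ⟨affineBlowup.idealSheaf I, affineBlowup.idealSheaf_ne_bot hI0,
    (FCForallExistsCylinder.mem_support_idealSheaf_iff I b).mpr hb, fun X' π hπ x' _ => ?_⟩
  obtain ⟨x'', -, ⟨e⟩⟩ := IsBlowupStalkTransfer.stub_isBlowupStalkTransfer _ _ _ _ π (affineBlowup.π I) hπ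
    (affineBlowup.isBlowup I) x'
  obtain ⟨hdom, hcl⟩ := affineBlowup_full k f hf I hI x''
  haveI := hdom
  exact ⟨MulEquiv.isDomain _ e.toMulEquiv,
    DegreeZeroDescent.inlineClause_of_ringEquiv 2 (L := (affineBlowup I).presheaf.stalk x'') (L' := X'.presheaf.stalk x') e.symm hcl⟩

/-- **The padded monomial centre is the reduced singular line: `I_A R̄ = (ȳ, t̄)`** (`A = {e₀, e₂, 2e₀, 2e₂, e₀+e₁, e₂+e₁}`: every
exponent involves `y` or `t`, and `y = x^{e₀}`, `t = x^{e₂}` belong to `A`). [folklore] -/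
theorem centre_eq_span_pair (k : Type) [Field k] (f : MvPolynomial (Fin 3) k) :
    Ideal.span ((fun e : Fin 3 →₀ ℕ => Ideal.Quotient.mk (Ideal.span {f}) (monomial e (1 : k))) '' (Fan02of3.A : Set (Fin 3 →₀ ℕ))) =
      Ideal.span {Ideal.Quotient.mk (Ideal.span {f}) (X 0), Ideal.Quotient.mk (Ideal.span {f}) (X 2)} := by
  apply le_antisymm
  · rw [Ideal.span_le]
    rintro _ ⟨a, ha, rfl⟩
    obtain ⟨j, hj, hja⟩ := Fan02of3.hAJ a ha
    have hdvd : (X j : MvPolynomial (Fin 3) k) ∣ monomial a 1 :=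
      monomial_dvd_monomial.mpr ⟨Or.inr (Finsupp.single_le_iff.mpr hja), one_dvd _⟩
    obtain ⟨q, hq⟩ := hdvd
    change Ideal.Quotient.mk (Ideal.span {f}) (monomial a 1) ∈ _
    rw [hq, map_mul]
    refine Ideal.mul_mem_right _ _ ?_
    simp only [Fan02of3.J, Finset.mem_insert, Finset.mem_singleton] at hj
    rcases hj with rfl | rfl
    · exact Ideal.subset_span (Set.mem_insert _ _)
    · exact Ideal.subset_span (Set.mem_insert_of_mem _ (Set.mem_singleton _))
  · have hm : ∀ c : Fin 2, Ideal.Quotient.mk (Ideal.span {f}) (X (Fan02of3.jc c)) ∈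
        Ideal.span ((fun e : Fin 3 →₀ ℕ => Ideal.Quotient.mk (Ideal.span {f}) (monomial e (1 : k))) '' (Fan02of3.A : Set (Fin 3 →₀ ℕ))) := by
      intro c
      have h : Ideal.Quotient.mk (Ideal.span {f}) (monomial (Fan02of3.m c) (1 : k)) ∈
          Ideal.span ((fun e : Fin 3 →₀ ℕ => Ideal.Quotient.mk (Ideal.span {f}) (monomial e (1 : k))) '' (Fan02of3.A : Set (Fin 3 →₀ ℕ))) :=
        Ideal.subset_span ⟨Fan02of3.m c, Fan02of3.hmA c, rfl⟩
      rwa [Fan02of3.m_eq_single, ← X_pow_eq_monomial, pow_one] at h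
    rw [Ideal.span_le]
    rintro _ (rfl | rfl)
    · exact hm 0
    · exact hm 1

/-- **#4β AT THE WILD PINCH — `closedCentreExists` for `X₁ = Spec k[y,u,t]/(y²+u²ty+ut²)`, `char k = 2`, WITH CENTRE THE REDUCED
SINGULAR LINE `I = (ȳ, t̄)`, AT EVERY POINT `b ∈ V(I)`** (in particular at the origin, strat-1's wild pinch point, where the point form
5e fails): `J := Ĩ ≠ ⊥`, `b ∈ supp J`, and EVERY blowing up `π : X' → X₁` along `J` has all its stalks over `supp J` domains
satisfying the crux clause. Literally the conclusion of door v30's `stub_closedCentreExists` for this `X₁` and these `b`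
(`closedCentreExists_wildPinch_A` + `centre_eq_span_pair`). [folklore mathematics; OURS as a certificate] -/
theorem closedCentreExists_wildPinch (k : Type) [Field k] [CharP k 2] (f : MvPolynomial (Fin 3) k)
    (hf : f = X 0 ^ 2 + X 1 ^ 2 * X 2 * X 0 + X 1 * X 2 ^ 2)
    (I : Ideal (MvPolynomial (Fin 3) k ⧸ Ideal.span {f}))
    (hI : I = Ideal.span {Ideal.Quotient.mk (Ideal.span {f}) (X 0), Ideal.Quotient.mk (Ideal.span {f}) (X 2)})
    (b : ↥(Spec (.of (MvPolynomial (Fin 3) k ⧸ Ideal.span {f})))) (hb : I ≤ b.asIdeal) :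
    ∃ J : (Spec (.of (MvPolynomial (Fin 3) k ⧸ Ideal.span {f}))).IdealSheafData, J ≠ ⊥ ∧
      b ∈ (J.support : Set ↥(Spec (.of (MvPolynomial (Fin 3) k ⧸ Ideal.span {f})))) ∧
      ∀ (X' : Scheme.{0}) (π : X' ⟶ Spec (.of (MvPolynomial (Fin 3) k ⧸ Ideal.span {f}))),
        Literature.AlgebraicGeometry.Resolution.IsBlowup π J →
        ∀ x' : X', π.base x' ∈ (J.support : Set ↥(Spec (.of (MvPolynomial (Fin 3) k ⧸ Ideal.span {f})))) →
          IsDomain (X'.presheaf.stalk x') ∧ ∀ d : ℕ, ringKrullDim (X'.presheaf.stalk x') = d →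
            ∀ s : Fin d → X'.presheaf.stalk x', (Ideal.span (Set.range s)).radical.IsMaximal →
              RingTheory.Sequence.IsWeaklyRegular (X'.presheaf.stalk x') (List.ofFn s) ∧
              ∀ z : X'.presheaf.stalk x', (∃ e : ℕ, z ^ 2 ^ e ∈
                  Ideal.span ((fun w : X'.presheaf.stalk x' => w ^ 2 ^ e) ''
                    (Ideal.span (Set.range s) : Set (X'.presheaf.stalk x')))) → z ∈ Ideal.span (Set.range s) :=
  closedCentreExists_wildPinch_A k f hf I (hI.trans (centre_eq_span_pair k f).symm) b hb

/-! ## §5 Door-shaped corollary: #4β for `X₁` at every closed BAD point (v2 append) -/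

/-- **Off the centre the wild pinch surface satisfies the clause**: for a maximal `Q ⊉ (ȳ, t̄)` of `R̄ = k[y,u,t]/(f)`, the local ring
`R̄_Q` satisfies the crux clause (`∂f/∂u = t² ∉ Q`, since `t ∈ Q` forces `y² = f − t(u²y + ut) ∈ Q`, i.e. `(ȳ, t̄) ≤ Q`). [folklore] -/
theorem clause_off_centre (k : Type) [Field k] [CharP k 2] (f : MvPolynomial (Fin 3) k)
    (hf : f = X 0 ^ 2 + X 1 ^ 2 * X 2 * X 0 + X 1 * X 2 ^ 2)
    (Q : Ideal (MvPolynomial (Fin 3) k ⧸ Ideal.span {f})) [Q.IsMaximal]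
    (hQ : ¬ Ideal.span {Ideal.Quotient.mk (Ideal.span {f}) (X 0), Ideal.Quotient.mk (Ideal.span {f}) (X 2)} ≤ Q) :
    ∀ d : ℕ, ringKrullDim (Localization.AtPrime Q) = d → ∀ s : Fin d → Localization.AtPrime Q,
      (Ideal.span (Set.range s)).radical.IsMaximal →
        RingTheory.Sequence.IsWeaklyRegular (Localization.AtPrime Q) (List.ofFn s) ∧
        ∀ y : Localization.AtPrime Q, (∃ e : ℕ, y ^ 2 ^ e ∈ Ideal.span
          ((fun z : Localization.AtPrime Q => z ^ 2 ^ e) ''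
            (Ideal.span (Set.range s) : Set (Localization.AtPrime Q)))) → y ∈ Ideal.span (Set.range s) := by
  haveI : Fact (Nat.Prime 2) := ⟨Nat.prime_two⟩
  refine ClauseOfPderivNotMem.stub_clauseOfPderivNotMem 2 k 3 f Q 1 ?_
  rw [pderiv_one_f k f hf]
  intro h2
  have hP : (Q.comap (Ideal.Quotient.mk (Ideal.span {f}))).IsPrime := Ideal.comap_isPrime _ _
  have hX2 : (X 2 : MvPolynomial (Fin 3) k) ∈ Q.comap (Ideal.Quotient.mk (Ideal.span {f})) := hP.mem_of_pow_mem 2 h2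
  have hfP : f ∈ Q.comap (Ideal.Quotient.mk (Ideal.span {f})) := by
    rw [Ideal.mem_comap, Ideal.Quotient.eq_zero_iff_mem.mpr (Ideal.mem_span_singleton_self f)]
    exact zero_mem _
  have hX0 : (X 0 : MvPolynomial (Fin 3) k) ∈ Q.comap (Ideal.Quotient.mk (Ideal.span {f})) := by
    refine hP.mem_of_pow_mem 2 ?_
    have h02 : (X 0 : MvPolynomial (Fin 3) k) ^ 2 = f - X 2 * (X 1 ^ 2 * X 0 + X 1 * X 2) := by rw [hf]; ring
    rw [h02]
    exact sub_mem hfP (Ideal.mul_mem_right _ _ hX2)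
  refine hQ (Ideal.span_le.mpr ?_)
  rintro _ (rfl | rfl)
  · exact Ideal.mem_comap.mp hX0
  · exact Ideal.mem_comap.mp hX2

/-- **#4β FOR THE WILD PINCH SURFACE AT EVERY CLOSED BAD POINT — the body of door v30's `stub_closedCentreExists` for
`X₁ = Spec k[y,u,t]/(y²+u²ty+ut²)` (`char k = 2`), with its global hypotheses not even needed**: a closed point `b` at which some
parameter ideal of `𝒪_{X₁,b}` fails to be Frobenius closed lies on `V(ȳ, t̄)` (elsewhere `X₁` is regular: `clause_off_centre`, moved to
the stalk along `Spec.stalkIso`), and there `closedCentreExists_wildPinch` supplies `J = (ȳ, t̄)~`. [OURS as a certificate] -/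
theorem closedCentreExists_wildPinch_bad (k : Type) [Field k] [CharP k 2] (f : MvPolynomial (Fin 3) k)
    (hf : f = X 0 ^ 2 + X 1 ^ 2 * X 2 * X 0 + X 1 * X 2 ^ 2)
    (b : ↥(Spec (.of (MvPolynomial (Fin 3) k ⧸ Ideal.span {f}))))
    (hb : IsClosed ({b} : Set ↥(Spec (.of (MvPolynomial (Fin 3) k ⧸ Ideal.span {f})))))
    (hbad : ¬ ∀ d : ℕ, ringKrullDim ((Spec (.of (MvPolynomial (Fin 3) k ⧸ Ideal.span {f}))).presheaf.stalk b) = d →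
      ∀ s : Fin d → (Spec (.of (MvPolynomial (Fin 3) k ⧸ Ideal.span {f}))).presheaf.stalk b,
        (Ideal.span (Set.range s)).radical.IsMaximal →
          ∀ y : (Spec (.of (MvPolynomial (Fin 3) k ⧸ Ideal.span {f}))).presheaf.stalk b, (∃ e : ℕ, y ^ 2 ^ e ∈
            Ideal.span ((fun z : (Spec (.of (MvPolynomial (Fin 3) k ⧸ Ideal.span {f}))).presheaf.stalk b => z ^ 2 ^ e) ''
              (Ideal.span (Set.range s) : Set ((Spec (.of (MvPolynomial (Fin 3) k ⧸ Ideal.span {f}))).presheaf.stalk b)))) →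
            y ∈ Ideal.span (Set.range s)) :
    ∃ J : (Spec (.of (MvPolynomial (Fin 3) k ⧸ Ideal.span {f}))).IdealSheafData, J ≠ ⊥ ∧
      b ∈ (J.support : Set ↥(Spec (.of (MvPolynomial (Fin 3) k ⧸ Ideal.span {f})))) ∧
      ∀ (X' : Scheme.{0}) (π : X' ⟶ Spec (.of (MvPolynomial (Fin 3) k ⧸ Ideal.span {f}))),
        Literature.AlgebraicGeometry.Resolution.IsBlowup π J →
        ∀ x' : X', π.base x' ∈ (J.support : Set ↥(Spec (.of (MvPolynomial (Fin 3) k ⧸ Ideal.span {f})))) →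
          IsDomain (X'.presheaf.stalk x') ∧ ∀ d : ℕ, ringKrullDim (X'.presheaf.stalk x') = d →
            ∀ s : Fin d → X'.presheaf.stalk x', (Ideal.span (Set.range s)).radical.IsMaximal →
              RingTheory.Sequence.IsWeaklyRegular (X'.presheaf.stalk x') (List.ofFn s) ∧
              ∀ z : X'.presheaf.stalk x', (∃ e : ℕ, z ^ 2 ^ e ∈
                  Ideal.span ((fun w : X'.presheaf.stalk x' => w ^ 2 ^ e) ''
                    (Ideal.span (Set.range s) : Set (X'.presheaf.stalk x')))) → z ∈ Ideal.span (Set.range s) := by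
  by_cases hIb : Ideal.span {Ideal.Quotient.mk (Ideal.span {f}) (X 0), Ideal.Quotient.mk (Ideal.span {f}) (X 2)} ≤ b.asIdeal
  · exact closedCentreExists_wildPinch k f hf _ rfl b hIb
  · exfalso
    haveI : b.asIdeal.IsMaximal := (PrimeSpectrum.isClosed_singleton_iff_isMaximal b).mp hb
    haveI : Fact (Nat.Prime 2) := ⟨Nat.prime_two⟩
    have hcl := clause_off_centre k f hf b.asIdeal hIb
    let e : ((Spec (.of (MvPolynomial (Fin 3) k ⧸ Ideal.span {f}))).presheaf.stalk b) ≃+* Localization.AtPrime b.asIdeal :=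
      (Spec.stalkIso (.of (MvPolynomial (Fin 3) k ⧸ Ideal.span {f})) b).commRingCatIsoToRingEquiv
    have hcl' := DegreeZeroDescent.inlineClause_of_ringEquiv 2 (L := Localization.AtPrime b.asIdeal)
      (L' := (Spec (.of (MvPolynomial (Fin 3) k ⧸ Ideal.span {f}))).presheaf.stalk b) e.symm hcl
    exact hbad fun d hd s hs => (hcl' d hd s hs).2

end Summit.ResolutionOfSingularities.ResolutionOfSingularities.Theorems.FInjectiveMacaulayfication.WildPinchClosedCentre
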